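import Literature.Probability.Percolation.TreeGraphBoundFour
import Literature.Barriers.CriticalPhenomena.SpanningClustersAboveSixLatticeSums
import HarnessLib

/-!
# Diagram and moment bounds for the spanning-cluster barrier (Aizenman 1997, Lemmas 2–3, `k ≤ 2`)

Barrier catalogue `Literature/Barriers/CriticalPhenomena/` (D-0021), companion of
`SpanningClustersAboveSix.lean` (Aizenman 1997, Thm. 4). Under the upper two-point bound
`τ_p(x,y) ≤ C₁ max(1,‖x-y‖_∞)^{-(d-2)}` (condition (t-c) with `η = 0`, upper half, regularised at
`x = y` where `τ = 1`), on `ℤ^d` with `d = m + 7 > 6`, for the faces `∂Λ_- = plate (m+6) L (-L)`,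
`∂Λ_+ = plate (m+6) L L` of `Λ_L = [-L,L]^d`, all PROVED:

* `sum_plate_tau_le` — `Σ_{x ∈ ∂Λ_∓} τ(x,u) ≤ C₁ (K₁+1)(2L+1)` uniformly in `u`
  (the mean number of face points connected to a given vertex is `O(L)`);
* `three_chain_le` — `Σ_{u,v} τ(x,u)τ(u,v)τ(v,y) ≤ C₁³ K² max(1,‖x-y‖)^{-(d-6)}` (two convolutions,
  `d > 6`), uniformly over finite ranges;
* `sum_treeDiagram_le` — for fixed internal vertices `(u,v)`, the sum over
  `x,x' ∈ ∂Λ_-`, `y,y' ∈ ∂Λ_+` of the three tree diagrams (`treeDiagram`, `TreeGraphBoundFour.lean`)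
  is at most `3B² F(u)τ(u,v)G(v)` with `F(u) = Σ_{x∈∂Λ_-} τ(x,u)`, `G(v) = Σ_{y∈∂Λ_+} τ(v,y)`
  (both `≤ B`);
* `sum_sum_treeDiagram_le` — the **tree-diagram estimate** behind Aizenman 1997, Lemma 2 and the proof of Lemma 3
  for two pairs: `Σ_{x,x',y,y'} Σ_{u,v} treeDiagram ≤ C_diag L^{d+6}` for `L ≥ 1`, uniformly over
  finite ranges of `(u,v)` ("the addition of two sites and three lines … translates to the
  multiplicative factor of order `L^{2d}/L^{3(d-2)} = 1/L^{d-6}`" relative to `(E K)² ≍ L^{2d}`);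
* `sum_real_openConn₄_le` — hence, by the four-point tree-graph bound
  (`measure_openConn₄_le_tsum_tau`),
  `T := Σ_{x,x'∈∂Λ_-, y,y'∈∂Λ_+} τ₄(x,x',y,y') ≤ C_diag L^{d+6}`,
  which is both `E Σ_C |C∩∂Λ_-|²|C∩∂Λ_+|²` and the bound on `Var K` (Aizenman 1997, proof of Lemma 3);
* `le_sum_faces_tau` — the lower two-point bound gives `E K = Σ_{x∈∂Λ_-,y∈∂Λ_+} τ(x,y) ≥ c L^d`
  (Aizenman 1997, proof of Lemma 3: `E(K) ≈ L^{2(d-1)}/L^{d-2} = L^d`).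

## References

* M. Aizenman, *On the number of incipient spanning clusters*, Nuclear Phys. B 485 (1997)
  551–582, arXiv:cond-mat/9609240, §4 of the arXiv version ("Above the upper critical
  dimension"; equations (4.x); the catalogue file `SpanningClustersAboveSix.lean` refers to the
  same section as §5): Lemma 2, Lemma 3 and their proofs (tree-diagram bound; `K`, `E(K)`, `Var(K)`).
* M. Aizenman, C. M. Newman, J. Stat. Phys. 36 (1984) 107–143, §4.
-/

noncomputable section

namespace Literature.Barriers.CriticalPhenomena

open _root_.MeasureTheory Finset Literature.Probability.LatticeModels Literature.Probability.Percolation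
open scoped ENNReal

variable {m : ℕ} (p : unitInterval) {C₁ : ℝ}

/-! ### The regularised upper two-point bound -/

section UpperBound

/-- From the upper half of (t-c) in natural-power form (`TwoPointBoundedRatio.natPow`),
`τ(x,y) ≤ C/‖x-y‖^{d-2}` for `x ≠ y`, to the regularised form
`τ(x,y) ≤ max(C,1)·rieszRadius(x-y)^{-(d-2)}` valid for all `x, y` (`τ(x,x) = 1`); here `d = m + 7`,
`d - 2 = m + 5`. [folklore] -/
theorem tau_le_rieszWt_of_upper {C : ℝ}
    (hU : ∀ x y : Site (m + 7), x ≠ y → tau (m + 7) p x y ≤ C * (‖x - y‖ ^ (m + 5))⁻¹)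
    (x y : Site (m + 7)) : tau (m + 7) p x y ≤ max C 1 * rieszWt (m + 5) (x - y) := by
  by_cases hxy : x = y
  · subst hxy
    rw [tau_self, sub_self, rieszWt_zero, mul_one]
    exact le_max_right _ _
  · rw [rieszWt_eq_inv_norm_pow _ (sub_ne_zero.2 hxy)]
    exact (hU x y hxy).trans (mul_le_mul_of_nonneg_right (le_max_left _ _)
      (inv_nonneg.2 (pow_nonneg (norm_nonneg _) _)))

/-- The constant of a regularised upper bound `τ ≤ C₁·rieszWt` is at least `1` (take `x = y`).
[folklore] -/
theorem one_le_of_tau_le_rieszWt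
    (hU : ∀ x y : Site (m + 7), tau (m + 7) p x y ≤ C₁ * rieszWt (m + 5) (x - y)) : 1 ≤ C₁ := by
  have h := hU 0 0
  rwa [tau_self, sub_self, rieszWt_zero, mul_one] at h

variable (hU : ∀ x y : Site (m + 7), tau (m + 7) p x y ≤ C₁ * rieszWt (m + 5) (x - y))
include hU

/-- **Face sums of the two-point function**: `Σ_{x ∈ plate} τ(x,u) ≤ C₁ (K₁+1)(2L+1)` uniformly in
`u` (Aizenman 1997, proof of Lemma 3: the mean number of points of a face connected to a vertex is `O(L)`).
[cite: Aizenman1997, §4 (proof of Lemma 3: E(K))] -/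
theorem sum_plate_tau_le (L : ℕ) (c : ℤ) (u : Site (m + 7)) :
    ∑ x ∈ plate (m + 6) L c, tau (m + 7) p x u ≤
      C₁ * (rieszPlateConst (m + 6) * (2 * (L : ℝ) + 1)) :=
  have hC₁ : 0 ≤ C₁ := zero_le_one.trans (one_le_of_tau_le_rieszWt p hU)
  calc ∑ x ∈ plate (m + 6) L c, tau (m + 7) p x u
      ≤ ∑ x ∈ plate (m + 6) L c, C₁ * rieszWt (m + 5) (x - u) := Finset.sum_le_sum fun x _ => hU x u
    _ = C₁ * ∑ x ∈ plate (m + 6) L c, rieszWt (m + 5) (x - u) := by rw [Finset.mul_sum]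
    _ ≤ C₁ * (rieszPlateConst (m + 6) * (2 * (L : ℝ) + 1)) :=
        mul_le_mul_of_nonneg_left (sum_plate_rieszWt_sub_le (n := m + 6) (a := m + 5) (by omega) L c u) hC₁

/-- Face sums with the arguments of `τ` exchanged: `Σ_{x ∈ plate} τ(u,x) ≤ C₁ (K₁+1)(2L+1)`.
[cite: Aizenman1997, §4 (proof of Lemma 3: E(K))] -/
theorem sum_plate_tau_le' (L : ℕ) (c : ℤ) (u : Site (m + 7)) :
    ∑ x ∈ plate (m + 6) L c, tau (m + 7) p u x ≤
      C₁ * (rieszPlateConst (m + 6) * (2 * (L : ℝ) + 1)) := by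
  simp_rw [tau_comm p u]
  exact sum_plate_tau_le p hU L c u

/-- **Three-line chain** (`d = m + 7 > 6`): `Σ_{u ∈ U₁, v ∈ U₂} τ(x,u) τ(u,v) τ(v,y) ≤
C₁³ K² rieszRadius(x-y)^{-(d-6)}`, by two applications of the convolution bound
(`|x|^{2-d} * |x|^{2-d} ≲ |x|^{4-d}`, then `* |x|^{2-d} ≲ |x|^{6-d}`), uniformly over finite ranges.
[cite: Aizenman1997, §4 (proof of Lemma 3: L^{2d}/L^{3(d-2+η)})] -/
theorem three_chain_le (x y : Site (m + 7)) (U₁ U₂ : Finset (Site (m + 7))) :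
    ∑ u ∈ U₁, ∑ v ∈ U₂, tau (m + 7) p x u * (tau (m + 7) p u v * tau (m + 7) p v y) ≤
      C₁ ^ 3 * rieszConvConst (m + 7) ^ 2 * rieszWt (m + 1) (x - y) := by
  have hC₁ : 0 ≤ C₁ := zero_le_one.trans (one_le_of_tau_le_rieszWt p hU)
  have hK : 0 ≤ rieszConvConst (m + 7) := (rieszConvConst_pos _).le
  calc ∑ u ∈ U₁, ∑ v ∈ U₂, tau (m + 7) p x u * (tau (m + 7) p u v * tau (m + 7) p v y)
      ≤ ∑ u ∈ U₁, ∑ v ∈ U₂, (C₁ * rieszWt (m + 5) (x - u)) *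
          ((C₁ * rieszWt (m + 5) (u - v)) * (C₁ * rieszWt (m + 5) (v - y))) :=
        Finset.sum_le_sum fun u _ => Finset.sum_le_sum fun v _ =>
          mul_le_mul (hU x u) (mul_le_mul (hU u v) (hU v y) (tau_nonneg _ _ _)
            (mul_nonneg hC₁ (rieszWt_nonneg _ _))) (mul_nonneg (tau_nonneg _ _ _) (tau_nonneg _ _ _))
            (mul_nonneg hC₁ (rieszWt_nonneg _ _))
    _ = C₁ ^ 3 * ∑ v ∈ U₂, (∑ u ∈ U₁, rieszWt (m + 5) (x - u) * rieszWt (m + 5) (u - v)) *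
          rieszWt (m + 5) (v - y) := by
        rw [Finset.sum_comm, Finset.mul_sum]
        refine Finset.sum_congr rfl fun v _ => ?_
        rw [Finset.sum_mul, Finset.mul_sum]
        refine Finset.sum_congr rfl fun u _ => ?_
        ring
    _ ≤ C₁ ^ 3 * ∑ v ∈ U₂, (rieszConvConst (m + 7) * rieszWt (m + 3) (x - v)) * rieszWt (m + 5) (v - y) := by
        gcongr with v _
        · exact rieszWt_nonneg _ _
        · have h := sum_rieszWt_mul_rieszWt_le (d := m + 7) (t := m + 2) (i := 1) (j := 1) (by omega) x v U₁
          exact h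
    _ = C₁ ^ 3 * (rieszConvConst (m + 7) *
          ∑ v ∈ U₂, rieszWt (m + 3) (x - v) * rieszWt (m + 5) (v - y)) := by
        congr 1
        rw [Finset.mul_sum]
        exact Finset.sum_congr rfl fun v _ => by ring
    _ ≤ C₁ ^ 3 * (rieszConvConst (m + 7) * (rieszConvConst (m + 7) * rieszWt (m + 1) (x - y))) := by
        gcongr
        exact sum_rieszWt_mul_rieszWt_le (d := m + 7) (t := m) (i := 3) (j := 1) (by omega) x y U₂
    _ = C₁ ^ 3 * rieszConvConst (m + 7) ^ 2 * rieszWt (m + 1) (x - y) := by ring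

end UpperBound

/-! ### Tree-diagram sums over the faces -/

section Diagrams

/-- Factorisation of a double sum over `A × A`: `Σ_{(a,b)} h(a) (c k(b)) = (Σ h)(c Σ k)`. [folklore] -/
private theorem sum_product_mul_const_mul {ι : Type*} (A : Finset ι) (h k : ι → ℝ) (c : ℝ) :
    ∑ q ∈ A ×ˢ A, h q.1 * (c * k q.2) = (∑ a ∈ A, h a) * (c * ∑ b ∈ A, k b) := by
  rw [Finset.sum_product, Finset.sum_mul]
  refine Finset.sum_congr rfl fun a _ => ?_
  rw [Finset.mul_sum, Finset.mul_sum]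

/-- Factorisation of a sum of products over `P × Q`: `Σ_{(x,y)} f(x) g(y) = (Σ_P f)(Σ_Q g)`. [folklore] -/
private theorem sum_product_mul_eq {ι : Type*} (P Q : Finset ι) (f g : ι → ℝ) :
    ∑ a ∈ P ×ˢ Q, f a.1 * g a.2 = (∑ x ∈ P, f x) * ∑ y ∈ Q, g y := by
  rw [Finset.sum_product, Finset.sum_mul_sum]

/-- Monotonicity of a product of five non-negative factors in the second and fourth factor.
[folklore] -/
private theorem mul_five_le_mul_five {a b b' c e e' f : ℝ} (ha : 0 ≤ a) (hb : 0 ≤ b) (hc : 0 ≤ c) (he : 0 ≤ e)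
    (hf : 0 ≤ f) (hbb' : b ≤ b') (hee' : e ≤ e') :
    a * b * (c * (e * f)) ≤ a * b' * (c * (e' * f)) := by
  have h1 : a * b ≤ a * b' := mul_le_mul_of_nonneg_left hbb' ha
  have h2 : e * f ≤ e' * f := mul_le_mul_of_nonneg_right hee' hf
  have h3 : c * (e * f) ≤ c * (e' * f) := mul_le_mul_of_nonneg_left h2 hc
  exact mul_le_mul h1 h3 (mul_nonneg hc (mul_nonneg he hf)) (mul_nonneg ha (hb.trans hbb'))

end Diagrams

section FaceDiagrams

variable (hU : ∀ x y : Site (m + 7), tau (m + 7) p x y ≤ C₁ * rieszWt (m + 5) (x - y))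
include hU

/-- The face-sum bound `B = C₁ (K₁+1)(2L+1)`. [folklore] -/
def spanningFaceBound (m : ℕ) (C₁ : ℝ) (L : ℕ) : ℝ := C₁ * (rieszPlateConst (m + 6) * (2 * (L : ℝ) + 1))

omit hU in
/-- `B ≥ 0`. [folklore] -/
theorem spanningFaceBound_nonneg (hC₁ : 0 ≤ C₁) (L : ℕ) : 0 ≤ spanningFaceBound m C₁ L := by
  unfold spanningFaceBound
  have := one_le_rieszPlateConst (m + 6)
  positivity

/-- **Tree diagrams summed over the faces, fixed internal vertices** (Aizenman 1997, proofs of Lemmas 2–3,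
bookkeeping for `k = 2`): with `A = ∂Λ_- × ∂Λ_+`, `F(u) = Σ_{x∈∂Λ_-} τ(x,u)`,
`G(v) = Σ_{y∈∂Λ_+} τ(v,y)` (both `≤ B`),
`Σ_{((x,y),(x',y')) ∈ A × A} treeDiagram(x,x',y,y';u,v) ≤ 3 B² F(u) τ(u,v) G(v)`.
[cite: Aizenman1997, §4 (proofs of Lemmas 2 and 3)] -/
theorem sum_treeDiagram_le (L : ℕ) (u v : Site (m + 7)) :
    ∑ q ∈ (plate (m + 6) L (-(L : ℤ)) ×ˢ plate (m + 6) L L) ×ˢ (plate (m + 6) L (-(L : ℤ)) ×ˢ plate (m + 6) L L),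
        treeDiagram p q.1.1 q.2.1 q.1.2 q.2.2 u v ≤
      3 * spanningFaceBound m C₁ L ^ 2 * ((∑ x ∈ plate (m + 6) L (-(L : ℤ)), tau (m + 7) p x u) *
        (tau (m + 7) p u v * ∑ y ∈ plate (m + 6) L L, tau (m + 7) p v y)) := by
  set P := plate (m + 6) L (-(L : ℤ)) with hP
  set Q := plate (m + 6) L (L : ℤ) with hQ
  set A := P ×ˢ Q with hA
  set B := spanningFaceBound m C₁ L with hB
  have hFle : ∀ w, ∑ x ∈ P, tau (m + 7) p x w ≤ B := fun w => sum_plate_tau_le p hU L _ w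
  have hGle : ∀ w, ∑ y ∈ Q, tau (m + 7) p w y ≤ B := fun w => sum_plate_tau_le' p hU L _ w
  have hF0 : ∀ w, 0 ≤ ∑ x ∈ P, tau (m + 7) p x w := fun w => Finset.sum_nonneg fun x _ => tau_nonneg _ _ _
  have hG0 : ∀ w, 0 ≤ ∑ y ∈ Q, tau (m + 7) p w y := fun w => Finset.sum_nonneg fun y _ => tau_nonneg _ _ _
  have hτ0 := tau_nonneg (d := m + 7) p u v
  -- factorisation of the sums over `A = P × Q`
  have eF : ∀ w w' : Site (m + 7), ∑ a ∈ A, tau (m + 7) p a.1 w * tau (m + 7) p w' a.2 =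
      (∑ x ∈ P, tau (m + 7) p x w) * ∑ y ∈ Q, tau (m + 7) p w' y := fun w w' => by
    have e := sum_product_mul_eq P Q (fun x => tau (m + 7) p x w) (fun y => tau (m + 7) p w' y)
    beta_reduce at e
    rw [hA]
    exact e
  -- the three diagrams factorise
  have h1 : ∑ q ∈ A ×ˢ A, tau (m + 7) p q.1.1 u * (tau (m + 7) p q.2.1 u *
      (tau (m + 7) p u v * (tau (m + 7) p v q.1.2 * tau (m + 7) p v q.2.2))) =
      ((∑ x ∈ P, tau (m + 7) p x u) * ∑ y ∈ Q, tau (m + 7) p v y) *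
        (tau (m + 7) p u v * ((∑ x ∈ P, tau (m + 7) p x u) * ∑ y ∈ Q, tau (m + 7) p v y)) := by
    have e1 := sum_product_mul_const_mul A (fun a => tau (m + 7) p a.1 u * tau (m + 7) p v a.2)
      (fun b => tau (m + 7) p b.1 u * tau (m + 7) p v b.2) (tau (m + 7) p u v)
    beta_reduce at e1
    rw [eF] at e1
    refine Eq.trans (Finset.sum_congr rfl fun q _ => ?_) e1
    ring
  have h2 : ∑ q ∈ A ×ˢ A, tau (m + 7) p q.1.1 u * (tau (m + 7) p q.1.2 u *
      (tau (m + 7) p u v * (tau (m + 7) p v q.2.1 * tau (m + 7) p v q.2.2))) =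
      ((∑ x ∈ P, tau (m + 7) p x u) * ∑ y ∈ Q, tau (m + 7) p u y) *
        (tau (m + 7) p u v * ((∑ x ∈ P, tau (m + 7) p x v) * ∑ y ∈ Q, tau (m + 7) p v y)) := by
    have e1 := sum_product_mul_const_mul A (fun a => tau (m + 7) p a.1 u * tau (m + 7) p u a.2)
      (fun b => tau (m + 7) p b.1 v * tau (m + 7) p v b.2) (tau (m + 7) p u v)
    beta_reduce at e1
    rw [eF, eF] at e1
    refine Eq.trans (Finset.sum_congr rfl fun q _ => ?_) e1
    rw [tau_comm p q.1.2 u, tau_comm p v q.2.1]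
    ring
  have h3 : ∑ q ∈ A ×ˢ A, tau (m + 7) p q.1.1 u * (tau (m + 7) p q.2.2 u *
      (tau (m + 7) p u v * (tau (m + 7) p v q.2.1 * tau (m + 7) p v q.1.2))) =
      ((∑ x ∈ P, tau (m + 7) p x u) * ∑ y ∈ Q, tau (m + 7) p v y) *
        (tau (m + 7) p u v * ((∑ x ∈ P, tau (m + 7) p x v) * ∑ y ∈ Q, tau (m + 7) p u y)) := by
    have e1 := sum_product_mul_const_mul A (fun a => tau (m + 7) p a.1 u * tau (m + 7) p v a.2)
      (fun b => tau (m + 7) p b.1 v * tau (m + 7) p u b.2) (tau (m + 7) p u v)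
    beta_reduce at e1
    rw [eF, eF] at e1
    refine Eq.trans (Finset.sum_congr rfl fun q _ => ?_) e1
    rw [tau_comm p q.2.2 u, tau_comm p v q.2.1]
    ring
  -- sum of the three, each bounded by `B² F(u) τ G(v)`
  have hsplit : ∑ q ∈ A ×ˢ A, treeDiagram p q.1.1 q.2.1 q.1.2 q.2.2 u v =
      ((∑ x ∈ P, tau (m + 7) p x u) * ∑ y ∈ Q, tau (m + 7) p v y) *
        (tau (m + 7) p u v * ((∑ x ∈ P, tau (m + 7) p x u) * ∑ y ∈ Q, tau (m + 7) p v y)) +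
      ((∑ x ∈ P, tau (m + 7) p x u) * ∑ y ∈ Q, tau (m + 7) p u y) *
        (tau (m + 7) p u v * ((∑ x ∈ P, tau (m + 7) p x v) * ∑ y ∈ Q, tau (m + 7) p v y)) +
      ((∑ x ∈ P, tau (m + 7) p x u) * ∑ y ∈ Q, tau (m + 7) p v y) *
        (tau (m + 7) p u v * ((∑ x ∈ P, tau (m + 7) p x v) * ∑ y ∈ Q, tau (m + 7) p u y)) := by
    simp only [treeDiagram, Finset.sum_add_distrib]
    rw [h1, h2, h3]
  rw [hsplit]
  have b1 := mul_five_le_mul_five (hF0 u) (hG0 v) hτ0 (hF0 u) (hG0 v) (hGle v) (hFle u)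
  have b2 := mul_five_le_mul_five (hF0 u) (hG0 u) hτ0 (hF0 v) (hG0 v) (hGle u) (hFle v)
  have b3' := mul_five_le_mul_five (hF0 u) (hF0 v) hτ0 (hG0 u) (hG0 v) (hFle v) (hGle u)
  have b3 : ((∑ x ∈ P, tau (m + 7) p x u) * ∑ y ∈ Q, tau (m + 7) p v y) *
        (tau (m + 7) p u v * ((∑ x ∈ P, tau (m + 7) p x v) * ∑ y ∈ Q, tau (m + 7) p u y)) ≤
      ((∑ x ∈ P, tau (m + 7) p x u) * B) * (tau (m + 7) p u v * (B * ∑ y ∈ Q, tau (m + 7) p v y)) := by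
    refine le_trans (le_of_eq ?_) b3'
    ring
  refine (add_le_add (add_le_add b1 b2) b3).trans (le_of_eq ?_)
  ring

omit hU in
/-- Opposite faces are far apart in the Riesz weight: for `x ∈ ∂Λ_-`, `y ∈ ∂Λ_+`, `L ≥ 1`,
`rieszRadius(x-y)^{-b} ≤ (2L)^{-b}`. [folklore] -/
theorem rieszWt_faces_le (b : ℕ) {L : ℕ} (hL : 1 ≤ L) {x y : Site (m + 7)}
    (hx : x ∈ plate (m + 6) L (-(L : ℤ))) (hy : y ∈ plate (m + 6) L L) :
    rieszWt b (x - y) ≤ ((((2 * L : ℕ) : ℝ)) ^ b)⁻¹ :=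
  rieszWt_le_inv_pow b (by omega) (two_mul_le_supNorm_sub_of_mem_plate hx hy)

/-- The constant `C_diag` of the tree-diagram estimate (unoptimised). [folklore] -/
def spanningDiagConst (m : ℕ) (C₁ : ℝ) : ℝ :=
  3 ^ (2 * m + 15) * C₁ ^ 5 * rieszPlateConst (m + 6) ^ 2 * rieszConvConst (m + 7) ^ 2

omit hU in
/-- `C_diag ≥ 0` for `C₁ ≥ 0`. [folklore] -/
theorem spanningDiagConst_nonneg (hC₁ : 0 ≤ C₁) : 0 ≤ spanningDiagConst m C₁ := by
  unfold spanningDiagConst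
  have := one_le_rieszPlateConst (m + 6)
  positivity

/-- **The tree-diagram estimate for two pairs** (Aizenman 1997, Lemma 2 with the tree-diagram
bound, and proof of Lemma 3:
`Var K ≲ L^{2d}/L^{3(d-2)} (E K)² = L^{d+6}`): for `L ≥ 1` and every finite range `U` of internal
vertices, `Σ_{((x,y),(x',y')) ∈ A×A} Σ_{(u,v) ∈ U} treeDiagram(x,x',y,y';u,v) ≤ C_diag L^{d+6}`
(`d + 6 = m + 13`). [cite: Aizenman1997, §4 Lemma 2 and proof of Lemma 3] -/
theorem sum_sum_treeDiagram_le {L : ℕ} (hL : 1 ≤ L) (U : Finset (Site (m + 7) × Site (m + 7))) :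
    ∑ q ∈ (plate (m + 6) L (-(L : ℤ)) ×ˢ plate (m + 6) L L) ×ˢ (plate (m + 6) L (-(L : ℤ)) ×ˢ plate (m + 6) L L),
        ∑ uv ∈ U, treeDiagram p q.1.1 q.2.1 q.1.2 q.2.2 uv.1 uv.2 ≤
      spanningDiagConst m C₁ * (L : ℝ) ^ (m + 13) := by
  classical
  set P := plate (m + 6) L (-(L : ℤ)) with hP
  set Q := plate (m + 6) L (L : ℤ) with hQ
  set A := P ×ˢ Q with hA
  set B := spanningFaceBound m C₁ L with hB
  have hC₁ : 0 ≤ C₁ := zero_le_one.trans (one_le_of_tau_le_rieszWt p hU)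
  have hB0 : 0 ≤ B := spanningFaceBound_nonneg hC₁ L
  have hK := (rieszConvConst_pos (m + 7)).le
  rw [Finset.sum_comm]
  -- Step 1: fixed `(u,v)`
  have step1 : ∑ uv ∈ U, ∑ q ∈ A ×ˢ A, treeDiagram p q.1.1 q.2.1 q.1.2 q.2.2 uv.1 uv.2 ≤
      3 * B ^ 2 * ∑ uv ∈ U, (∑ x ∈ P, tau (m + 7) p x uv.1) *
        (tau (m + 7) p uv.1 uv.2 * ∑ y ∈ Q, tau (m + 7) p uv.2 y) := by
    rw [Finset.mul_sum]
    exact Finset.sum_le_sum fun uv _ => sum_treeDiagram_le p hU L uv.1 uv.2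
  -- Step 2: `Σ_{(u,v) ∈ U} F(u) τ(u,v) G(v) ≤ |A| C₁³ K² (2L)^{-(m+1)}`
  have step2 : ∑ uv ∈ U, (∑ x ∈ P, tau (m + 7) p x uv.1) *
      (tau (m + 7) p uv.1 uv.2 * ∑ y ∈ Q, tau (m + 7) p uv.2 y) ≤
      #A * (C₁ ^ 3 * rieszConvConst (m + 7) ^ 2 * ((((2 * L : ℕ) : ℝ)) ^ (m + 1))⁻¹) := by
    have e : ∀ uv : Site (m + 7) × Site (m + 7), (∑ x ∈ P, tau (m + 7) p x uv.1) *
        (tau (m + 7) p uv.1 uv.2 * ∑ y ∈ Q, tau (m + 7) p uv.2 y) =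
        ∑ a ∈ A, tau (m + 7) p a.1 uv.1 * (tau (m + 7) p uv.1 uv.2 * tau (m + 7) p uv.2 a.2) := by
      intro uv
      rw [hA, Finset.sum_product, Finset.sum_mul]
      refine Finset.sum_congr rfl fun x _ => ?_
      rw [Finset.mul_sum, Finset.mul_sum]
    simp_rw [e]
    rw [Finset.sum_comm]
    have hpt : ∀ a ∈ A, ∑ uv ∈ U, tau (m + 7) p a.1 uv.1 * (tau (m + 7) p uv.1 uv.2 * tau (m + 7) p uv.2 a.2) ≤
        C₁ ^ 3 * rieszConvConst (m + 7) ^ 2 * ((((2 * L : ℕ) : ℝ)) ^ (m + 1))⁻¹ := by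
      intro a ha
      obtain ⟨hx, hy⟩ := Finset.mem_product.1 ha
      calc ∑ uv ∈ U, tau (m + 7) p a.1 uv.1 * (tau (m + 7) p uv.1 uv.2 * tau (m + 7) p uv.2 a.2)
          ≤ ∑ uv ∈ U.image Prod.fst ×ˢ U.image Prod.snd,
              tau (m + 7) p a.1 uv.1 * (tau (m + 7) p uv.1 uv.2 * tau (m + 7) p uv.2 a.2) :=
            Finset.sum_le_sum_of_subset_of_nonneg Finset.subset_product fun uv _ _ =>
              mul_nonneg (tau_nonneg _ _ _) (mul_nonneg (tau_nonneg _ _ _) (tau_nonneg _ _ _))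
        _ = ∑ u ∈ U.image Prod.fst, ∑ v ∈ U.image Prod.snd,
              tau (m + 7) p a.1 u * (tau (m + 7) p u v * tau (m + 7) p v a.2) := Finset.sum_product _ _ _
        _ ≤ C₁ ^ 3 * rieszConvConst (m + 7) ^ 2 * rieszWt (m + 1) (a.1 - a.2) :=
            three_chain_le p hU a.1 a.2 _ _
        _ ≤ C₁ ^ 3 * rieszConvConst (m + 7) ^ 2 * ((((2 * L : ℕ) : ℝ)) ^ (m + 1))⁻¹ :=
            mul_le_mul_of_nonneg_left (rieszWt_faces_le (m + 1) hL hx hy) (by positivity)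
    calc ∑ a ∈ A, ∑ uv ∈ U, tau (m + 7) p a.1 uv.1 * (tau (m + 7) p uv.1 uv.2 * tau (m + 7) p uv.2 a.2)
        ≤ ∑ a ∈ A, C₁ ^ 3 * rieszConvConst (m + 7) ^ 2 * ((((2 * L : ℕ) : ℝ)) ^ (m + 1))⁻¹ :=
          Finset.sum_le_sum hpt
      _ = #A * (C₁ ^ 3 * rieszConvConst (m + 7) ^ 2 * ((((2 * L : ℕ) : ℝ)) ^ (m + 1))⁻¹) := by
          rw [Finset.sum_const, nsmul_eq_mul]
  -- Step 3: the arithmetic in `L`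
  have hcardA : (#A : ℝ) = (2 * (L : ℝ) + 1) ^ (m + 6) * (2 * (L : ℝ) + 1) ^ (m + 6) := by
    rw [hA, Finset.card_product, hP, hQ, card_plate, card_plate]; push_cast; ring
  have hL1 : (1 : ℝ) ≤ L := by exact_mod_cast hL
  have h3L : 2 * (L : ℝ) + 1 ≤ 3 * L := by linarith
  have hBle : B ≤ C₁ * rieszPlateConst (m + 6) * (3 * L) := by
    rw [hB, spanningFaceBound, ← mul_assoc]
    exact mul_le_mul_of_nonneg_left h3L (mul_nonneg hC₁ (by linarith [one_le_rieszPlateConst (m + 6)]))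
  have hAle : (#A : ℝ) ≤ (3 * L) ^ (m + 6) * (3 * L) ^ (m + 6) := by
    rw [hcardA]
    exact mul_le_mul (pow_le_pow_left₀ (by positivity) h3L _) (pow_le_pow_left₀ (by positivity) h3L _)
      (by positivity) (by positivity)
  have hinv : ((((2 * L : ℕ) : ℝ)) ^ (m + 1))⁻¹ ≤ ((L : ℝ) ^ (m + 1))⁻¹ := by
    push_cast
    exact inv_anti₀ (by positivity) (pow_le_pow_left₀ (by positivity) (by linarith) _)
  calc ∑ uv ∈ U, ∑ q ∈ A ×ˢ A, treeDiagram p q.1.1 q.2.1 q.1.2 q.2.2 uv.1 uv.2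
      ≤ 3 * B ^ 2 * (#A * (C₁ ^ 3 * rieszConvConst (m + 7) ^ 2 * ((((2 * L : ℕ) : ℝ)) ^ (m + 1))⁻¹)) :=
        step1.trans (mul_le_mul_of_nonneg_left step2 (by positivity))
    _ ≤ 3 * (C₁ * rieszPlateConst (m + 6) * (3 * L)) ^ 2 *
          (((3 * L) ^ (m + 6) * (3 * L) ^ (m + 6)) * (C₁ ^ 3 * rieszConvConst (m + 7) ^ 2 * ((L : ℝ) ^ (m + 1))⁻¹)) := by
        gcongr
    _ = spanningDiagConst m C₁ * ((L : ℝ) ^ (2 * m + 14) * ((L : ℝ) ^ (m + 1))⁻¹) := by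
        rw [spanningDiagConst]; ring
    _ = spanningDiagConst m C₁ * (L : ℝ) ^ (m + 13) := by
        have hL0 : (L : ℝ) ≠ 0 := by positivity
        rw [show 2 * m + 14 = (m + 13) + (m + 1) by ring, pow_add, mul_assoc ((L : ℝ) ^ (m + 13)),
          mul_inv_cancel₀ (pow_ne_zero _ hL0), mul_one]

/-- **`T ≤ C_diag L^{d+6}`** (Aizenman 1997, proof of Lemma 3, by the tree-diagram bound used in
Lemma 2): summing the
four-point tree-graph bound `τ₄ ≤ Σ_{u,v} treeDiagram` (`measure_openConn₄_le_tsum_tau`) over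
`x, x' ∈ ∂Λ_-`, `y, y' ∈ ∂Λ_+` gives
`T = Σ P_p(x, x', y, y' all connected) ≤ C_diag L^{d+6}` for `L ≥ 1`. This `T` is
`E Σ_C |C∩∂Λ_-|² |C∩∂Λ_+|²` and bounds `Var K`.
[cite: Aizenman1997, §4 Lemma 2 and proof of Lemma 3 (Var(K))] -/
theorem sum_real_openConn₄_le {L : ℕ} (hL : 1 ≤ L) :
    ∑ q ∈ (plate (m + 6) L (-(L : ℤ)) ×ˢ plate (m + 6) L L) ×ˢ (plate (m + 6) L (-(L : ℤ)) ×ˢ plate (m + 6) L L),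
        (bondPercolation (zdGraph (m + 7)) p).real (openConn₄ q.1.1 q.2.1 q.1.2 q.2.2) ≤
      spanningDiagConst m C₁ * (L : ℝ) ^ (m + 13) := by
  classical
  set μ := bondPercolation (zdGraph (m + 7)) p with hμ
  set QQ := (plate (m + 6) L (-(L : ℤ)) ×ˢ plate (m + 6) L L) ×ˢ (plate (m + 6) L (-(L : ℤ)) ×ˢ plate (m + 6) L L)
    with hQQ
  set f : ((Site (m + 7) × Site (m + 7)) × (Site (m + 7) × Site (m + 7))) → (Site (m + 7) × Site (m + 7)) → ℝ :=
    fun q uv => treeDiagram p q.1.1 q.2.1 q.1.2 q.2.2 uv.1 uv.2 with hf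
  have hf0 : ∀ q uv, 0 ≤ f q uv := fun q uv => treeDiagram_nonneg p _ _ _ _ _ _
  have hC₁ : 0 ≤ C₁ := zero_le_one.trans (one_le_of_tau_le_rieszWt p hU)
  have hbound : 0 ≤ spanningDiagConst m C₁ * (L : ℝ) ^ (m + 13) :=
    mul_nonneg (spanningDiagConst_nonneg hC₁) (by positivity)
  -- in `ℝ≥0∞`: union bound, interchange of the finite sum with the `tsum`, and the uniform bound
  have hE : ∑ q ∈ QQ, μ (openConn₄ q.1.1 q.2.1 q.1.2 q.2.2) ≤
      ENNReal.ofReal (spanningDiagConst m C₁ * (L : ℝ) ^ (m + 13)) := by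
    calc ∑ q ∈ QQ, μ (openConn₄ q.1.1 q.2.1 q.1.2 q.2.2)
        ≤ ∑ q ∈ QQ, ∑' uv : Site (m + 7) × Site (m + 7), ENNReal.ofReal (f q uv) :=
          Finset.sum_le_sum fun q _ => measure_openConn₄_le_tsum_tau p _ _ _ _
      _ = ∑' uv : Site (m + 7) × Site (m + 7), ∑ q ∈ QQ, ENNReal.ofReal (f q uv) :=
          (Summable.tsum_finsetSum fun _ _ => ENNReal.summable).symm
      _ ≤ ENNReal.ofReal (spanningDiagConst m C₁ * (L : ℝ) ^ (m + 13)) := by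
          rw [ENNReal.tsum_eq_iSup_sum]
          refine iSup_le fun U => ?_
          calc ∑ uv ∈ U, ∑ q ∈ QQ, ENNReal.ofReal (f q uv)
              = ∑ uv ∈ U, ENNReal.ofReal (∑ q ∈ QQ, f q uv) :=
                Finset.sum_congr rfl fun uv _ => (ENNReal.ofReal_sum_of_nonneg fun q _ => hf0 q uv).symm
            _ = ENNReal.ofReal (∑ uv ∈ U, ∑ q ∈ QQ, f q uv) :=
                (ENNReal.ofReal_sum_of_nonneg fun uv _ => Finset.sum_nonneg fun q _ => hf0 q uv).symm
            _ ≤ ENNReal.ofReal (spanningDiagConst m C₁ * (L : ℝ) ^ (m + 13)) := ENNReal.ofReal_le_ofReal (by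
                rw [Finset.sum_comm]; exact sum_sum_treeDiagram_le p hU hL U)
  -- back to real numbers
  have hreal : ∑ q ∈ QQ, μ.real (openConn₄ q.1.1 q.2.1 q.1.2 q.2.2) =
      (∑ q ∈ QQ, μ (openConn₄ q.1.1 q.2.1 q.1.2 q.2.2)).toReal := by
    rw [ENNReal.toReal_sum fun q _ => measure_ne_top _ _]
    rfl
  rw [hreal, ← ENNReal.toReal_ofReal hbound]
  exact ENNReal.toReal_mono ENNReal.ofReal_ne_top hE

end FaceDiagrams

/-! ### The lower bound on `E K` -/

section LowerBound

/-- **`E K ≥ c L^d`** (Aizenman 1997, proof of Lemma 3: `E(K) = Σ_{x∈∂Λ_-,y∈∂Λ_+} τ(x,y) ≈ L^{2(d-1)}/L^{d-2}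
= L^d`): under the lower half of (t-c), `τ(x,y) ≥ C'/‖x-y‖^{d-2}` for `x ≠ y`, and since points of
`Λ_L` are within sup distance `2L`, `Σ_{(x,y) ∈ ∂Λ_- × ∂Λ_+} τ_p(x,y) ≥ C' 2^d L^d` for `L ≥ 1`
(`d = m + 7`). [cite: Aizenman1997, §4 (proof of Lemma 3: E(K))] -/
theorem le_sum_faces_tau {C' : ℝ} (hC' : 0 ≤ C')
    (hLow : ∀ x y : Site (m + 7), x ≠ y → C' * (‖x - y‖ ^ (m + 5))⁻¹ ≤ tau (m + 7) p x y)
    {L : ℕ} (hL : 1 ≤ L) :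
    C' * 2 ^ (m + 7) * (L : ℝ) ^ (m + 7) ≤
      ∑ a ∈ plate (m + 6) L (-(L : ℤ)) ×ˢ plate (m + 6) L L, tau (m + 7) p a.1 a.2 := by
  set A := plate (m + 6) L (-(L : ℤ)) ×ˢ plate (m + 6) L L with hA
  have hL0 : (0 : ℝ) < L := by exact_mod_cast hL
  have h2L : (0 : ℝ) < 2 * L := by positivity
  -- each term is at least `C' (2L)^{-(d-2)}`
  have hterm : ∀ a ∈ A, C' * ((2 * (L : ℝ)) ^ (m + 5))⁻¹ ≤ tau (m + 7) p a.1 a.2 := by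
    intro a ha
    obtain ⟨hx, hy⟩ := Finset.mem_product.1 ha
    have hne : a.1 ≠ a.2 := by
      intro h
      have h1 := (mem_plate.1 hx).1
      have h2 := (mem_plate.1 hy).1
      rw [h] at h1
      rw [h1] at h2
      have : (L : ℤ) = 0 := by linarith
      omega
    have hbL : -(L : ℤ) ≤ L := by omega
    have hdist : ‖a.1 - a.2‖ ≤ 2 * L := by
      rw [Site.norm_eq_supNorm]
      exact_mod_cast supNorm_sub_le_of_mem_box (plate_subset_box ⟨le_rfl, hbL⟩ hx)
        (plate_subset_box ⟨hbL, le_rfl⟩ hy)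
    have hpos : 0 < ‖a.1 - a.2‖ := norm_pos_iff.2 (sub_ne_zero.2 hne)
    calc C' * ((2 * (L : ℝ)) ^ (m + 5))⁻¹ ≤ C' * (‖a.1 - a.2‖ ^ (m + 5))⁻¹ :=
          mul_le_mul_of_nonneg_left (inv_anti₀ (pow_pos hpos _) (pow_le_pow_left₀ hpos.le hdist _)) hC'
      _ ≤ tau (m + 7) p a.1 a.2 := hLow a.1 a.2 hne
  have hcard : (#A : ℝ) = (2 * (L : ℝ) + 1) ^ (m + 6) * (2 * (L : ℝ) + 1) ^ (m + 6) := by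
    rw [hA, Finset.card_product, card_plate, card_plate]; push_cast; ring
  calc C' * 2 ^ (m + 7) * (L : ℝ) ^ (m + 7)
      = (2 * (L : ℝ)) ^ (m + 6) * (2 * (L : ℝ)) ^ (m + 6) * (C' * ((2 * (L : ℝ)) ^ (m + 5))⁻¹) := by
        field_simp
        ring
    _ ≤ (#A : ℝ) * (C' * ((2 * (L : ℝ)) ^ (m + 5))⁻¹) := by
        rw [hcard]
        gcongr <;> linarith
    _ = #A • (C' * ((2 * (L : ℝ)) ^ (m + 5))⁻¹) := (nsmul_eq_mul _ _).symm
    _ ≤ ∑ a ∈ A, tau (m + 7) p a.1 a.2 := Finset.card_nsmul_le_sum A _ _ hterm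

end LowerBound


end Literature.Barriers.CriticalPhenomena

end
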